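import Literature.NumberTheory.EllipticCurves.Rank1Residual.X1CoeffOneRiemannSumCertificate
import Literature.NumberTheory.EllipticCurves.PAdicLFunctionIntegralityProofs
import Literature.NumberTheory.EllipticCurves.LeadingTermPPartProofs
import HarnessLib

/-!
# X1 ∩ {r_an ≥ 1}: the measure bound of the `[T^k]`-certificate is FREE — at positive analytic
# rank the Mazur–Swinnerton-Dyer measure `μ_{f,α}` of the newform of `E` is `ℤ_p`-valued, so ONE
# Riemann-sum inequality `p⁻ⁿ/‖k!‖_p < ‖RS(k, n)‖` certifies `[T^k]L_p(E,T) ≠ 0` (theorems only)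

Topic `Literature/NumberTheory/EllipticCurves/Rank1Residual`; a thin consumer of three tree files:
`PAdicLFunctionIntegralityProofs.lean` (`norm_msdMeasure_le_one`: for odd `p ∤ N`, `|α|_p = 1` and
an integer `n₀` prime to `p` with `n₀·{∞,0}_f ∈ Λ_f`, every value `μ_{f,α}(a + pⁿℤ_p)` has norm
`≤ 1` — Stevens 1989 §4 / Greenberg–Vatsal 2000 Prop. 3.7 / Mazur–Tate–Teitelbaum 1986 §I.10, from
the tree's `norm_ratPlusSymbol_le_one`), `LeadingTermPPartProofs.lean`
(`IsNewformOf.modularSymbol_zero_eq_entireLFunction_one`: `{∞,0}_f = L(E,1)`, Manin 1972 Thm. 1.3)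
and `Rank1Residual/X1CoeffOneRiemannSumCertificate.lean` (the `[T^k]`-certificate
`coeff_padicLFunction_ne_zero_of_riemannSum_certificate` with an explicit measure bound `C`).

THE POINT. When `L(E,1) = 0` — every pair of positive analytic rank, in particular every
X1 ∩ {r_an = 1} pair of the residual classes N1 / N1′ — the hypothesis `n₀·{∞,0}_f ∈ Λ_f` of
`norm_msdMeasure_le_one` holds with `n₀ = 1` for the trivial reason `{∞,0}_f = L(E,1) = 0 ∈ Λ_f`; no
Eisenstein number, no irreducibility and no non-anomaly condition is needed (contrast the
rank-`≥ 2` crux file `Cruxes/PAdicOrderThesisR2/C4UnitRiemannSumCertificate.lean`, which uses the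
Eisenstein number `a_p − p − 1` and therefore excludes the anomalous primes — exactly class X1). So
on X1 ∩ {r_an = 1} the measure bound `hC` of the certificate theorems is DISCHARGED with `C = 1`
(`norm_msdMeasure_unitRoot_le_one_of_entireLFunction_one_eq_zero`), and the certificate has ONE
numerical hypothesis left: `p⁻ⁿ/‖k!‖_p < ‖RS(k, n)‖` (`coeff_padicLFunction_ne_zero_of_riemannSum_lt`;
at `k = 1`: `p⁻ⁿ < ‖RS(1, n)‖`, i.e. `v_p(RS(1, n)) < n`), whence Schneider's non-degeneracy on X1
(`X1.schneider_of_riemannSum_lt_odd`, `X1.schneider_of_riemannSum_lt`).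

WHY (cell `b2b-bsdres`, lane CLASS-CLOSURE, classes N1 / N1′ = X1 ∩ {r = 1}; register
`HOME/class-closure/N1/PREDICTIONS-N1COEFF1.md` §5 / ADDENDA 5b–6): of the two per-row gaps left
after `X1CoeffOneRiemannSumCertificate.lean`, (g2′) 'the symbol denominator bound `c_den` must hold
at EVERY level, not only the delivered ones' is CLOSED by this file in the tree's own normalisation
(`c_den = 0` at every level is a theorem at positive analytic rank, odd good ordinary `p`); what
remains per instrument row is only (g2): the engines' `ω₁`-normalised symbol equals
`u_E·[·]⁺_f` for a rational `u_E` with `|u_E|_p = 1` (an instrument-dictionary statement about the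
engines, not about the tree). HONEST FRAMING: nothing about any curve is asserted; instrument rows
are EVIDENCE for `hlt` at a cell, never Literature facts; this file books nothing. No `sorry`,
no new definition, no new named fact (net fact debt 0).

## References
* [MazurTateTeitelbaum1986Invent] B. Mazur, J. Tate, J. Teitelbaum, *On `p`-adic analogues of the
  conjectures of Birch and Swinnerton-Dyer*, Invent. Math. 84 (1986) 1–48, §I.8 (8.6)
  (`[0]⁺ = L(f,1)/Ω⁺`), §I.10 (integrality of `μ_{f,α}`), §I.11 (Riemann sums).
* [Stevens1989] G. Stevens, *Stickelberger elements and modular parametrizations of elliptic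
  curves*, Invent. Math. 98 (1989) 75–106, §4 (values of modular symbols at unitary cusps lie in
  the period lattice up to Eisenstein numbers).
* [GreenbergVatsal2000] R. Greenberg, V. Vatsal, *On the Iwasawa invariants of elliptic curves*,
  Invent. Math. 142 (2000) 17–63, Prop. 3.7.
* [SteinWuthrich2013] W. Stein, C. Wuthrich, *Algorithms for the arithmetic of elliptic curves
  using Iwasawa theory*, Math. Comp. 82 (2013) 1757–1792, §3 Prop. 3.1 / 3.5 (precision of the
  Riemann-sum approximation).
* [PerrinRiou1987] B. Perrin-Riou, Bull. SMF 115 (1987) 399–456, §1.4 Cor. 1.8.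
-/


noncomputable section

open scoped Classical MatrixGroups ModularForm
open CongruenceSubgroup WeierstrassCurve Literature.NumberTheory.EllipticCurves
  Literature.NumberTheory.EllipticCurves.ModularForms

namespace Literature.NumberTheory.EllipticCurves

/-! ### `L(E,1) = 0 ⟹ μ_{f,α}` is `ℤ_p`-valued at every odd good ordinary `p` -/

section Elliptic

variable {N : ℕ} [NeZero N] {f : CuspForm (Gamma0 N) 2} {p : ℕ} [Fact p.Prime]
  {W : WeierstrassCurve ℚ} [W.IsElliptic] [W.IsGloballyMinimal]

/-- **`L(E,1) = 0 ⟹ |μ_{f,α}(a + pⁿℤ_p)|_p ≤ 1`** for the newform `f` of `E`, an odd good ordinary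
prime `p` of `E` and the unit root `α`: `{∞,0}_f = L(E,1) = 0 ∈ Λ_f`
(`IsNewformOf.modularSymbol_zero_eq_entireLFunction_one`), so `norm_msdMeasure_le_one` applies with
the integer `n₀ = 1` (prime to `p`), `p ∤ N` (`not_dvd_level_of_isNewformOf`) and `|α|_p = 1`
(`unitRoot_coe_spec`). [cite: MazurTateTeitelbaum1986Invent, §I.8 (8.6) and §I.10]
[cite: Stevens1989, §4] -/
theorem norm_msdMeasure_unitRoot_le_one_of_entireLFunction_one_eq_zero (hp2 : p ≠ 2)
    (hord : IsOrdinaryAt W p) (hf : IsNewformOf W f) (hL : W.entireLFunction 1 = 0)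
    (n : ℕ) (a : ZMod (p ^ n)) : ‖msdMeasure f (unitRoot W p : ℚ_[p]) n a‖ ≤ 1 := by
  have hp : p.Prime := Fact.out
  have hpN : ¬ p ∣ N := not_dvd_level_of_isNewformOf hf hord.1
  have hpn₀ : ¬ (p : ℤ) ∣ (1 : ℤ) := by
    intro h
    have h1 : (p : ℤ) ≤ 1 := Int.le_of_dvd one_pos h
    have h2 : (2 : ℤ) ≤ p := by exact_mod_cast hp.two_le
    omega
  have h0 : ((1 : ℤ) : ℂ) * modularSymbol f 0 ∈ periodLattice f := by
    rw [hf.modularSymbol_zero_eq_entireLFunction_one, hL, mul_zero]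
    exact (periodLattice f).zero_mem
  exact norm_msdMeasure_le_one hp2 hpN hpn₀ h0 (unitRoot_coe_spec (W := W) hord).2.1 n a

/-- **`r_an(E) = 1 ⟹ μ_{f,α}` is `ℤ_p`-valued** at every odd good ordinary prime (the case of the
residual classes N1 / N1′ = X1 ∩ {r = 1}): `L(E,1) = 0` at analytic rank one
(`entireLFunction_one_eq_zero_of_analyticRank_eq_one`). [cite: MazurTateTeitelbaum1986Invent, §I.10] -/
theorem norm_msdMeasure_unitRoot_le_one_of_analyticRank_eq_one (hp2 : p ≠ 2)
    (hord : IsOrdinaryAt W p) (hf : IsNewformOf W f) (han : W.analyticRank = 1)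
    (n : ℕ) (a : ZMod (p ^ n)) : ‖msdMeasure f (unitRoot W p : ℚ_[p]) n a‖ ≤ 1 :=
  norm_msdMeasure_unitRoot_le_one_of_entireLFunction_one_eq_zero hp2 hord hf
    (entireLFunction_one_eq_zero_of_analyticRank_eq_one (W := W) han) n a

/-! ### The one-hypothesis certificate: `p⁻ⁿ/‖k!‖_p < ‖RS(k, n)‖ ⟹ [T^k]L_p(E,T) ≠ 0` -/

/-- **`[T^k]`-certificate with the free bound `C = 1`.** For the newform `f` of `E`, an odd good
ordinary prime `p` with `L(E,1) = 0` and the unit root `α`: if ONE level-`n` Riemann sum satisfies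
`p⁻ⁿ/‖k!‖_p < ‖RS(k, n)‖_p`, then `‖[T^k]L_p(f,α,T)‖ = ‖RS(k, n)‖` and `[T^k]L_p(f,α,T) ≠ 0`
(`norm_coeff_padicLFunction_eq_of_riemannSum_certificate` /
`coeff_padicLFunction_ne_zero_of_riemannSum_certificate` with `C = 1` from
`norm_msdMeasure_unitRoot_le_one_of_entireLFunction_one_eq_zero`).
[cite: SteinWuthrich2013, §3 Prop. 3.1 / 3.5] [cite: MazurTateTeitelbaum1986Invent, §I.10–I.11] -/
theorem norm_coeff_padicLFunction_eq_of_riemannSum_lt (hp2 : p ≠ 2) (hord : IsOrdinaryAt W p)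
    (hf : IsNewformOf W f) (hL : W.entireLFunction 1 = 0) {k n : ℕ}
    (hlt : 1 / ‖((k.factorial : ℕ) : ℚ_[p])‖ * (p : ℝ) ^ (-n : ℤ) <
      ‖padicLRiemannSum f (unitRoot W p : ℚ_[p]) k n‖) :
    ‖PowerSeries.coeff k (padicLFunction f (unitRoot W p : ℚ_[p]))‖ =
        ‖padicLRiemannSum f (unitRoot W p : ℚ_[p]) k n‖ ∧
      PowerSeries.coeff k (padicLFunction f (unitRoot W p : ℚ_[p])) ≠ 0 :=
  ⟨norm_coeff_padicLFunction_eq_of_riemannSum_certificate hord hf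
      (norm_msdMeasure_unitRoot_le_one_of_entireLFunction_one_eq_zero hp2 hord hf hL) hlt,
    coeff_padicLFunction_ne_zero_of_riemannSum_certificate hord hf
      (norm_msdMeasure_unitRoot_le_one_of_entireLFunction_one_eq_zero hp2 hord hf hL) hlt⟩

/-- `[T^k]L_p(f,α,T) ≠ 0` from ONE Riemann-sum inequality `p⁻ⁿ/‖k!‖_p < ‖RS(k, n)‖` at positive
analytic rank (odd good ordinary `p`). [cite: SteinWuthrich2013, §3 Prop. 3.5] -/
theorem coeff_padicLFunction_ne_zero_of_riemannSum_lt (hp2 : p ≠ 2) (hord : IsOrdinaryAt W p)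
    (hf : IsNewformOf W f) (hL : W.entireLFunction 1 = 0) {k n : ℕ}
    (hlt : 1 / ‖((k.factorial : ℕ) : ℚ_[p])‖ * (p : ℝ) ^ (-n : ℤ) <
      ‖padicLRiemannSum f (unitRoot W p : ℚ_[p]) k n‖) :
    PowerSeries.coeff k (padicLFunction f (unitRoot W p : ℚ_[p])) ≠ 0 :=
  (norm_coeff_padicLFunction_eq_of_riemannSum_lt hp2 hord hf hL hlt).2

/-- **The `T¹` case at analytic rank one (classes N1 / N1′):** `p⁻ⁿ < ‖RS(1, n)‖_p` — i.e.
`v_p(RS(1, n)) < n` — gives `[T¹]L_p(f,α,T) ≠ 0` (`‖1!‖_p = 1`, `C = 1`).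
[cite: SteinWuthrich2013, §3 Prop. 3.5] -/
theorem coeff_one_padicLFunction_ne_zero_of_riemannSum_lt (hp2 : p ≠ 2) (hord : IsOrdinaryAt W p)
    (hf : IsNewformOf W f) (han : W.analyticRank = 1) {n : ℕ}
    (hlt : (p : ℝ) ^ (-n : ℤ) < ‖padicLRiemannSum f (unitRoot W p : ℚ_[p]) 1 n‖) :
    PowerSeries.coeff 1 (padicLFunction f (unitRoot W p : ℚ_[p])) ≠ 0 := by
  refine coeff_one_padicLFunction_ne_zero_of_riemannSum_certificate hord hf
    (norm_msdMeasure_unitRoot_le_one_of_analyticRank_eq_one hp2 hord hf han) (n := n) ?_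
  rwa [one_mul]

end Elliptic

/-! ### X1 ∩ {r_an = 1}: one Riemann-sum inequality ⟹ Schneider -/

namespace Rank1Residual

variable {N : ℕ} [NeZero N]

/-- **X1 ∩ {r_an = 1}, odd `p`: `p⁻ⁿ < ‖RS(1, n)‖_p` for ONE level `n` ⟹ Schneider's conjecture
for every canonical `p`-adic height datum** — `X1.schneider_of_riemannSum_certificate_odd` with the
free bound `C = 1` (`norm_msdMeasure_unitRoot_le_one_of_analyticRank_eq_one`; `2 < p` and good
ordinary are part of `ClassX1`). Inputs by name as there: Perrin-Riou 1987 Cor. 1.8 (`hPR`), GZK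
(`hGZK`). [cite: PerrinRiou1987, §1.4 Cor. 1.8] [cite: SteinWuthrich2013, §3 Prop. 3.5] -/
theorem X1.schneider_of_riemannSum_lt_odd (hPR : perrinRiou_rankOne_leadingTerms_odd)
    (hGZK : rank_eq_analyticRank_of_analyticRank_le_one)
    (W : WeierstrassCurve ℚ) [W.IsElliptic] [W.IsGloballyMinimal] (p : ℕ) [Fact p.Prime]
    (hX1 : ClassX1 W p) (han : W.analyticRank = 1)
    (f : CuspForm (Gamma0 N) 2) (hf : IsNewformOf W f) {n : ℕ}
    (hlt : (p : ℝ) ^ (-n : ℤ) < ‖padicLRiemannSum f (unitRoot W p : ℚ_[p]) 1 n‖) :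
    ∀ Dh : PAdicHeightData W p, Dh.IsCanonical → SchneiderConjecture Dh := by
  have hX := isClassX1_of_classX1 hX1
  have hp2 : p ≠ 2 := by have := hX1.1; omega
  refine X1.schneider_of_riemannSum_certificate_odd hPR hGZK W p hX1 han f hf
    (norm_msdMeasure_unitRoot_le_one_of_analyticRank_eq_one hp2
      ⟨hX.hasGoodReductionAtPrime, hX.not_dvd_frobeniusTrace⟩ hf han) (n := n) ?_
  rwa [one_mul]

/-- **X1 ∩ {r_an = 1}, `p ≥ 5` (every-`p` Perrin-Riou fact): `p⁻ⁿ < ‖RS(1, n)‖_p` ⟹ Schneider**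
(`X1.schneider_of_riemannSum_certificate` with `C = 1`).
[cite: PerrinRiou1987, §1.4 Cor. 1.8] [cite: SteinWuthrich2013, §3 Prop. 3.5] -/
theorem X1.schneider_of_riemannSum_lt (hPR : perrinRiou_rankOne_leadingTerms)
    (hGZK : rank_eq_analyticRank_of_analyticRank_le_one)
    (W : WeierstrassCurve ℚ) [W.IsElliptic] [W.IsGloballyMinimal] (p : ℕ) [Fact p.Prime]
    (hX1 : ClassX1 W p) (hp : 5 ≤ p) (han : W.analyticRank = 1)
    (f : CuspForm (Gamma0 N) 2) (hf : IsNewformOf W f) {n : ℕ}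
    (hlt : (p : ℝ) ^ (-n : ℤ) < ‖padicLRiemannSum f (unitRoot W p : ℚ_[p]) 1 n‖) :
    ∀ Dh : PAdicHeightData W p, Dh.IsCanonical → SchneiderConjecture Dh := by
  have hX := isClassX1_of_classX1 hX1
  have hp2 : p ≠ 2 := by omega
  refine X1.schneider_of_riemannSum_certificate hPR hGZK W p hX1 hp han f hf
    (norm_msdMeasure_unitRoot_le_one_of_analyticRank_eq_one hp2
      ⟨hX.hasGoodReductionAtPrime, hX.not_dvd_frobeniusTrace⟩ hf han) (n := n) ?_
  rwa [one_mul]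

end Rank1Residual

end Literature.NumberTheory.EllipticCurves

end
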